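import Summits.BirchSwinnertonDyer.Rank1Residual.GaloisImage.SmallImageNiveauDichotomy
import Summits.BirchSwinnertonDyer.Rank1Residual.GaloisImage.ThreeTorsionNiveauByJ
import Summits.BirchSwinnertonDyer.Rank1Residual.Additive.LocIrrInertiaStableLine
import Summits.BirchSwinnertonDyer.Rank1Residual.Additive.LocIrrValuationCriterionThreeProofs
import HarnessLib

/-!
# NIV3-J `GaloisImage.NiveauByJAtThree` is a THEOREM: on a tame inertia image at `3` the niveau is
# read on `v₃(j − 1728)` — for EVERY elliptic curve over `ℚ` and every prime `𝔓 ∣ 3` of `ℤ̄`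
# (cell `b2b-bsdres`, team n1011, prover lineage n1011-p06 GEN 30, row T-NIV3J file 2/2; the node
#  is cc-typer-1 GEN 8's census-discovered candidate law `GaloisImage/ThreeTorsionNiveauByJ.lean`,
#  p267289; THEOREMS ONLY)

HONEST FRAMING (cell `b2b-bsdres`, run/shared/lean/b2b/bsd-rank1-residual/, verbatim in every
file): the goal of the cell is to DELETE the COMBINATION-SHAPED residual classes of the
Birch–Swinnerton-Dyer formula for ALL analytic-rank `≤ 1` elliptic curves over `ℚ` — "full BSD
formula for every rank `≤ 1` curve in class `C`" assembled STRICTLY from published theorems — so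
that the rank-`≤ 1` remainder becomes exactly the CONSTRUCTION-SHAPED classes, which are TYPED
(missing-input `Prop`s), NOT attempted. This is not "finishing BSD". Research route on the
CONSTRUCTION-SHAPED additive classes; census output = EVIDENCE, never a Literature fact; nothing
is booked here; no mark / label / count of `RESIDUAL-MAP.md` moves; O8 / N11 stay OPEN. This
file: THEOREMS ONLY (no definition, no named fact, no `@[conjecture]` node, no `sorry`; net
named-fact debt `0`); no hypothesis beyond each target's own binders; no census number is an
input of anything.

## What is proved

* **`GaloisImage.niveauByJAtThree_holds : NiveauByJAtThree`** — the typed node NIV3-J, binders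
  verbatim: for every elliptic `W/ℚ`, every `v ∋ 3` with `f_v(W) ≥ 2`, every `𝔓 ∈ v.primesAbove`
  with `3 ∤ e₃ := #ρ̄_{W,3}(I_𝔓)`: `e₃ = 8 ↔ (j = 1728 ∨ 5 ≤ v₃(j − 1728))`.  The additivity
  binder `2 ≤ f_v` is NOT used: the law holds for every elliptic curve over `ℚ`
  (`GaloisImage.card_inertia_map_eq_eight_iff_j`), and its other branch reads `e₃ = 2 ↔
  (j ≠ 1728 ∧ v₃(j − 1728) < 5)` (`GaloisImage.card_inertia_map_eq_two_iff_j`).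
* ROUTE — three kernel steps over tree theorems already landed:
  (1) **`GaloisImage.locIrr_iff_card_inertia_map_eq_eight`** — at `p = 3`, `3 ∤ e₃`:
      `LocIrr W 3 ↔ e₃ = 8` ("`E[3]|G_{ℚ₃}` irreducible ⟺ `E[3]|_{I_𝔓}` has no stable line"):
      cc-typer-1's dichotomy `GaloisImage.card_inertia_map_three_eq_two_or_eq_eight` (`e₃ = 2 ∧
      InertiaSplitAt` or `e₃ = 8 ∧` no `I_𝔓`-stable line) fed into the two bridges of file 1/2
      `Additive/LocIrrInertiaStableLine.lean`, valid at every prime: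
      `Additive.locIrr_of_not_exists_inertia_stableLine` and `Additive.not_locIrr_of_inertiaSplitAt`.
  (2) harvest-2's L-O56-sel **`Additive.locIrr_three_iff_locIrrCriterionThree`** (p292696):
      `LocIrr W 3 ↔ c₄ ≠ 0 ∧ (c₆ = 0 ∨ 3·v₃c₄ + 2 ≤ 2·v₃c₆)`, any model.
  (3) **`Additive.locIrrCriterionThree_iff_j`** (§1 here) — valuation algebra on
      `1728Δ = c₄³ − c₆²` and `j − 1728 = c₆²/Δ` (re-derived inline; the tree's
      `Additive.j_sub_eq_c₆_sq_div_Δ` of `SelectorIdentityTameThreeProofs` is not imported): the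
      criterion ⟺ `j = 1728 ∨ 5 ≤ v₃(j − 1728)` (under
      the criterion `v₃Δ = 3v₃c₄ − 3`, so `v₃(j − 1728) = 2v₃c₆ − 3v₃c₄ + 3 ≥ 5`; conversely
      `5 ≤ 2v₃c₆ − v₃Δ` forces `c₄ ≠ 0` and `min(3v₃c₄, 2v₃c₆) ≤ v₃(c₄³ − c₆²) = 3 + v₃Δ ≤
      2v₃c₆ − 2`, whence `3v₃c₄ + 2 ≤ 2v₃c₆`).
  So NIV3-J reads `e₃ = 8 ⟺ LocIrr W 3 ⟺` criterion `⟺ (j = 1728 ∨ v₃(j − 1728) ≥ 5)`.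

READING (EVIDENCE framing, lane rule; wording offered to cc-typer-1 / the O8 sub-partition
`class-closure/O8/SUBPARTITION-typed.md` v1.8 row "census key for the split"): "NIV3-J is a
THEOREM — on every `E/ℚ` and every `𝔓 ∣ 3` with `3 ∤ e₃`: `e₃ = 8 ⟺ E[3]|G_{ℚ₃}` irreducible
`⟺ j = 1728 ∨ v₃(j − 1728) ≥ 5`; the census 1 334/1 334 + 441/441 stays EVIDENCE; nothing
booked; no mark."  `GaloisImage/ThreeTorsionNiveauByJ.lean` is UNTOUCHED (its doc-only restamp
"CANDIDATE ↦ THEOREM" is the typer's).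

References: J.-P. Serre, Invent. Math. 15 (1972) §1.3–§1.11 (niveau 1 / niveau 2 characters of
tame inertia) [Serre1972]; J. Neukirch, *Algebraic Number Theory* (1999) Ch. I §9, Ch. II §9
[NeukirchANT1999]; J. E. Cremona, *Algorithms for Modular Elliptic Curves* (2nd ed. 1997) §3.1 p. 45
(`j = c₄³/Δ`, `1728Δ = c₄³ − c₆²`), §3.9 p. 81 (`c₆ = 0 ⟺ j = 1728`) [Cremona1997]; J. H. Silverman,
*AEC* (2009) III.1 (the same identities) [SilvermanAEC2009]; A. Kraus, Manuscripta Math. 69 (1990)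
(the `3`-division field case analysis
the node's docstring anticipated; not needed on this route) [Kraus1990].
-/

set_option autoImplicit false

noncomputable section

open scoped Classical NumberField Pointwise

open Field IsDedekindDomain NumberField WeierstrassCurve
  Literature.NumberTheory.EllipticCurves Literature.NumberTheory.GaloisRepresentations
  Literature.NumberTheory.EllipticCurves.Rank1Residual Rat.HeightOneSpectrum

namespace Summit.BirchSwinnertonDyer.Rank1Residual.Additive

/-! ## §1 The `c₄/c₆` criterion for `LocIrr(3)` read on `j − 1728 = c₆²/Δ` -/

section Valuation

variable (W : WeierstrassCurve ℚ) [W.IsElliptic]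

/-- **The criterion `LocIrrCriterionThree W` (`c₄ ≠ 0 ∧ (c₆ = 0 ∨ 3v₃c₄ + 2 ≤ 2v₃c₆)`) ⟺
`j = 1728 ∨ 5 ≤ v₃(j − 1728)`** for every elliptic curve over `ℚ` (any model; both sides are
model invariants).  (⇒) `c₆ = 0` is `j = 1728`; else `v₃Δ = 3v₃c₄ − 3`
(`padicValRat_Δ_of_locIrrCriterionThree`) and `v₃(c₆²/Δ) = 2v₃c₆ − 3v₃c₄ + 3 ≥ 5`.  (⇐) on the
second disjunct `c₆ ≠ 0` (Lean's `v₃(0) = 0 < 5`); `c₄ = 0` would give `v₃(c₆²/Δ) = v₃(1728) = 3`;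
and `2v₃c₆ ≤ 3v₃c₄ + 1` would give `3 + v₃Δ = v₃(c₄³ − c₆²) ≥ 2v₃c₆ − 1`, i.e. `v₃(c₆²/Δ) ≤ 4`.
[cite: SilvermanAEC2009, III.1] [cite: Cremona1997, §3.1 (p. 45) and §3.9 (p. 81)] -/
theorem locIrrCriterionThree_iff_j :
    LocIrrCriterionThree W ↔ (W.j = 1728 ∨ 5 ≤ padicValRat 3 (W.j - 1728)) := by
  have hΔ : W.Δ ≠ 0 := W.isUnit_Δ.ne_zero
  -- `j − 1728 = c₆²/Δ` (`j = c₄³/Δ`, `1728Δ = c₄³ − c₆²`; cf. the tree's `Additive.j_sub_eq_c₆_sq_div_Δ`)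
  have hsub : W.j - 1728 = W.c₆ ^ 2 / W.Δ := by
    rw [WeierstrassCurve.j, Units.val_inv_eq_inv_val, W.coe_Δ', eq_div_iff hΔ]
    have := W.c_relation
    field_simp
    linear_combination -this
  have hrel : W.c₄ ^ 3 - W.c₆ ^ 2 = 1728 * W.Δ := W.c_relation.symm
  have h1728 : padicValRat 3 (1728 : ℚ) = 3 := by
    have h3 : padicValRat 3 (3 : ℚ) = 1 := by
      have := padicValRat.self (p := 3) (by norm_num)
      simpa using this
    have h64 : padicValRat 3 (64 : ℚ) = 0 := by
      have : (64 : ℚ) = ((64 : ℕ) : ℚ) := by norm_num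
      rw [this, padicValRat.of_nat]
      simp only [Nat.cast_eq_zero]
      exact padicValNat.eq_zero_of_not_dvd (by norm_num)
    have h : (1728 : ℚ) = (3 : ℚ) ^ 3 * 64 := by norm_num
    rw [h, padicValRat.mul (by norm_num) (by norm_num), padicValRat.pow (3 : ℚ), h3, h64]
    norm_num
  -- `v₃(c₄³ − c₆²) = 3 + v₃Δ`
  have hdiffv : padicValRat 3 (W.c₄ ^ 3 - W.c₆ ^ 2) = 3 + padicValRat 3 W.Δ := by
    rw [hrel, padicValRat.mul (by norm_num) hΔ, h1728]
  -- `v₃(j − 1728) = 2v₃c₆ − v₃Δ` when `c₆ ≠ 0`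
  have hjv : W.c₆ ≠ 0 → padicValRat 3 (W.j - 1728) = 2 * padicValRat 3 W.c₆ - padicValRat 3 W.Δ := by
    intro h6
    rw [hsub, padicValRat.div (pow_ne_zero 2 h6) hΔ, padicValRat.pow (W.c₆)]
    push_cast
    ring
  constructor
  · rintro ⟨h4, h⟩
    by_cases h6 : W.c₆ = 0
    · left
      have : W.j - 1728 = 0 := by rw [hsub, h6, zero_pow two_ne_zero, zero_div]
      linarith
    · right
      have hle : 3 * padicValRat 3 W.c₄ + 2 ≤ 2 * padicValRat 3 W.c₆ := h.resolve_left h6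
      have hd := padicValRat_Δ_of_locIrrCriterionThree W ⟨h4, h⟩
      rw [hjv h6, hd]
      linarith
  · intro h
    -- on the second disjunct `c₆ ≠ 0`; the first disjunct is `c₆ = 0`
    by_cases h6 : W.c₆ = 0
    · refine ⟨?_, Or.inl h6⟩
      intro h4
      apply hΔ
      have : (1728 : ℚ) * W.Δ = 0 := by rw [← hrel, h4, h6]; ring
      simpa using this
    have h5 : 5 ≤ padicValRat 3 (W.j - 1728) := by
      rcases h with hj | h5
      · exfalso
        have : W.c₆ ^ 2 / W.Δ = 0 := by rw [← hsub, hj, sub_self]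
        exact h6 (pow_eq_zero_iff two_ne_zero |>.mp ((div_eq_zero_iff.mp this).resolve_right hΔ))
      · exact h5
    rw [hjv h6] at h5
    have hc6v : padicValRat 3 (-(W.c₆ ^ 2)) = 2 * padicValRat 3 W.c₆ := by
      rw [padicValRat.neg, padicValRat.pow (W.c₆)]; push_cast; ring
    have hdiff : W.c₄ ^ 3 - W.c₆ ^ 2 ≠ 0 := by rw [hrel]; exact mul_ne_zero (by norm_num) hΔ
    -- `c₄ ≠ 0`
    have h4 : W.c₄ ≠ 0 := by
      intro h4
      have : padicValRat 3 (W.c₄ ^ 3 - W.c₆ ^ 2) = 2 * padicValRat 3 W.c₆ := by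
        rw [h4, zero_pow three_ne_zero, zero_sub, hc6v]
      rw [hdiffv] at this
      linarith
    refine ⟨h4, Or.inr ?_⟩
    by_contra hlt
    rw [not_le] at hlt
    have hc4v : padicValRat 3 (W.c₄ ^ 3) = 3 * padicValRat 3 W.c₄ := by
      rw [padicValRat.pow (W.c₄)]; push_cast; ring
    -- `min(3v₃c₄, 2v₃c₆) ≤ v₃(c₄³ − c₆²) = 3 + v₃Δ`
    have hmin := padicValRat.min_le_padicValRat_add (p := 3) (q := W.c₄ ^ 3) (r := -(W.c₆ ^ 2))
      (by rwa [← sub_eq_add_neg])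
    rw [← sub_eq_add_neg, hc4v, hc6v, hdiffv] at hmin
    have : 2 * padicValRat 3 W.c₆ - 1 ≤ min (3 * padicValRat 3 W.c₄) (2 * padicValRat 3 W.c₆) := by
      apply le_min <;> linarith
    linarith

end Valuation

end Summit.BirchSwinnertonDyer.Rank1Residual.Additive

/-! ## §2 `p = 3`: `LocIrr W 3 ↔ e₃ = 8`, and NIV3-J -/

namespace Summit.BirchSwinnertonDyer.Rank1Residual.GaloisImage

open Summit.BirchSwinnertonDyer.Rank1Residual.Additive
  Summit.BirchSwinnertonDyer.Rank1Residual.Additive.MixedCongruence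

section Three

variable {W : WeierstrassCurve ℚ} [W.IsElliptic] {p : ℕ} [hp : Fact p.Prime]

/-- **`3 ∤ e₃`: `E[3]|G_{ℚ₃}` irreducible ⟺ `e₃ = 8`** (⟺ NIVEAU 2, no `I_𝔓`-stable line), for every
elliptic `W/ℚ` and every `𝔓 ∣ 3` (stated with `p`, `hp3 : p = 3`). (⇐) §1's
`locIrr_of_not_exists_inertia_stableLine`; (⇒) on the other branch of cc-typer-1's dichotomy
(`e₃ = 2 ∧ InertiaSplitAt`) §1's `not_locIrr_of_inertiaSplitAt` applies. [cite: Serre1972, §1.3–§1.11] -/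
theorem locIrr_iff_card_inertia_map_eq_eight (hp3 : p = 3)
    {v : HeightOneSpectrum (𝓞 ℚ)} (hv : ((p : ℕ) : 𝓞 ℚ) ∈ v.asIdeal)
    {𝔓 : Ideal (absIntegers (𝓞 ℚ) ℚ)} (h𝔓 : 𝔓 ∈ v.primesAbove)
    (hI : ¬ p ∣ Nat.card ((𝔓.inertia (absoluteGaloisGroup ℚ)).map (galoisRepTorsion W p))) :
    LocIrr W p ↔ Nat.card ((𝔓.inertia (absoluteGaloisGroup ℚ)).map (galoisRepTorsion W p)) = 8 := by
  rw [← not_exists_stableLine_iff_card_inertia_map_eq_eight hp3 hv h𝔓 hI]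
  refine ⟨fun hL hex ↦ ?_, locIrr_of_not_exists_inertia_stableLine W p hv h𝔓⟩
  rcases card_inertia_map_three_eq_two_or_eq_eight (W := W) hp3 hv h𝔓 hI with ⟨h2, hs⟩ | ⟨-, hns⟩
  · exact not_locIrr_of_inertiaSplitAt W p hv h𝔓 hs (by rw [h2]; norm_num) hL
  · exact hns hex

/-- **`3 ∤ e₃`: `E[3]|G_{ℚ₃}` REDUCIBLE ⟺ `e₃ = 2`** (⟺ NIVEAU 1, `InertiaSplitAt`).
[cite: Serre1972, §1.3–§1.11] -/
theorem not_locIrr_iff_card_inertia_map_eq_two (hp3 : p = 3)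
    {v : HeightOneSpectrum (𝓞 ℚ)} (hv : ((p : ℕ) : 𝓞 ℚ) ∈ v.asIdeal)
    {𝔓 : Ideal (absIntegers (𝓞 ℚ) ℚ)} (h𝔓 : 𝔓 ∈ v.primesAbove)
    (hI : ¬ p ∣ Nat.card ((𝔓.inertia (absoluteGaloisGroup ℚ)).map (galoisRepTorsion W p))) :
    ¬ LocIrr W p ↔ Nat.card ((𝔓.inertia (absoluteGaloisGroup ℚ)).map (galoisRepTorsion W p)) = 2 := by
  rw [locIrr_iff_card_inertia_map_eq_eight hp3 hv h𝔓 hI]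
  rcases card_inertia_map_three_eq_two_or_eq_eight (W := W) hp3 hv h𝔓 hI with ⟨h2, -⟩ | ⟨h8, -⟩
  · rw [h2]; norm_num
  · rw [h8]; norm_num

/-- **NIV3-J for EVERY elliptic curve over `ℚ`** (no additivity hypothesis): at `p = 3`, for every
`𝔓 ∣ 3` with `3 ∤ e₃`, `e₃ = 8 ↔ (j = 1728 ∨ 5 ≤ v₃(j − 1728))` — §3's iff, harvest-2's L-O56-sel
`locIrr_three_iff_locIrrCriterionThree`, §2's `locIrrCriterionThree_iff_j`.
[cite: Serre1972, §1.3–§1.11] [cite: Cremona1997, §3.1 (p. 45) and §3.9 (p. 81)] -/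
theorem card_inertia_map_eq_eight_iff_j (hp3 : p = 3)
    {v : HeightOneSpectrum (𝓞 ℚ)} (hv : ((p : ℕ) : 𝓞 ℚ) ∈ v.asIdeal)
    {𝔓 : Ideal (absIntegers (𝓞 ℚ) ℚ)} (h𝔓 : 𝔓 ∈ v.primesAbove)
    (hI : ¬ p ∣ Nat.card ((𝔓.inertia (absoluteGaloisGroup ℚ)).map (galoisRepTorsion W p))) :
    Nat.card ((𝔓.inertia (absoluteGaloisGroup ℚ)).map (galoisRepTorsion W p)) = 8 ↔
      (W.j = 1728 ∨ 5 ≤ padicValRat 3 (W.j - 1728)) := by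
  rw [← locIrr_iff_card_inertia_map_eq_eight hp3 hv h𝔓 hI]
  subst hp3
  rw [locIrr_three_iff_locIrrCriterionThree, locIrrCriterionThree_iff_j]

/-- **The other branch: `e₃ = 2` (NIVEAU 1) ⟺ `j ≠ 1728 ∧ v₃(j − 1728) < 5`** — the node's clause
"and otherwise `e₃ = 2`", for every elliptic curve over `ℚ` and every `𝔓 ∣ 3` with `3 ∤ e₃`.
[cite: Serre1972, §1.3–§1.11] [cite: Cremona1997, §3.1 (p. 45) and §3.9 (p. 81)] -/
theorem card_inertia_map_eq_two_iff_j (hp3 : p = 3)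
    {v : HeightOneSpectrum (𝓞 ℚ)} (hv : ((p : ℕ) : 𝓞 ℚ) ∈ v.asIdeal)
    {𝔓 : Ideal (absIntegers (𝓞 ℚ) ℚ)} (h𝔓 : 𝔓 ∈ v.primesAbove)
    (hI : ¬ p ∣ Nat.card ((𝔓.inertia (absoluteGaloisGroup ℚ)).map (galoisRepTorsion W p))) :
    Nat.card ((𝔓.inertia (absoluteGaloisGroup ℚ)).map (galoisRepTorsion W p)) = 2 ↔
      (W.j ≠ 1728 ∧ padicValRat 3 (W.j - 1728) < 5) := by
  rw [← not_locIrr_iff_card_inertia_map_eq_two hp3 hv h𝔓 hI]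
  subst hp3
  rw [locIrr_three_iff_locIrrCriterionThree, locIrrCriterionThree_iff_j, not_or, not_le]

/-- **NIV3-J `NiveauByJAtThree` HOLDS** (cc-typer-1 GEN 8's census-discovered node, binders verbatim;
the binder `2 ≤ f_v(W)` is not used).
[cite: Serre1972, §1.3–§1.11] [cite: Cremona1997, §3.1 (p. 45) and §3.9 (p. 81)] -/
theorem niveauByJAtThree_holds : NiveauByJAtThree := by
  intro W _ v hv _ 𝔓 h𝔓 hI
  exact card_inertia_map_eq_eight_iff_j (W := W) (p := 3) rfl hv h𝔓 hI

end Three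

end Summit.BirchSwinnertonDyer.Rank1Residual.GaloisImage

end
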